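import Summits.KontsevichZagierPeriods.KontsevichZagierPeriods.Theses.SymplecticScissors
import Summits.KontsevichZagierPeriods.KontsevichZagierPeriods.Theorems.PlanarK0Injective.Negative.Kit
import Literature.NumberTheory.Transcendental.KZLogCalculusProofs

/-!
# Crux `SymplecticScissors.PlanarCompiler` (stmt-KontsevichZagierPeriods-10058), line
`twist-restoring-shear`, stub `stub_normalForm` — helper file I: the vertical shear

`G = planarGroup` is the subgroup of `KZ.FormalRep` generated by the instances of
Kontsevich–Zagier's rules (1a) (domain additivity) and (2) (change of variables) that are
`ℤ`-combinations of planar sets (integrand-`1` representations in dimension `2`); the bookkeeping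
in `G` (cuts, null modifications, finite almost-partitions) is that of
`SymplecticScissorsPlanarCompilerStubElementaryMovesAux`.  This file provides:

* termwise sums modulo `G` (`sum_sub_sum_mem_planarGroup`);
* **the vertical shear** `(x, y) ↦ (x, y − lo x)`: it carries the open band
  `{x ∈ U, lo x < y < hi x}` onto the cell `{x ∈ U, 0 < y < hi x − lo x}` by ONE instance of
  rule (2) with Jacobian determinant `1`, as soon as `lo` is `ℚ`-semialgebraic on `U` and
  differentiable at every point of `U` — no openness of `U` is needed
  (`of_sub_of_mem_changeOfVariablesRel_shear`, any dimension, adapted from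
  `KZ.of_sub_of_mem_relations_of_affine`; planar form modulo `G` in the coordinates of the cell
  compiler: `of_sub_of_mem_planarGroup_shear`).

All statements are folklore bookkeeping for [Kontsevich–Zagier 2001, §1.2, rule (2)].
Helpers live in the sub-namespace `…PlanarCompilerProof.NormalForm`; the registered sub-goal
`stub_normalForm_shear` (the planar shear, `G` written out) closes the file.
-/

noncomputable section

open MeasureTheory Set
open Literature.NumberTheory.Transcendental Literature.ModelTheory.ExponentialFields
open Summit.KontsevichZagierPeriods.SymplecticScissors.PlanarK0InjectiveNegative

namespace Summit.KontsevichZagierPeriods.SymplecticScissors.PlanarCompilerProof.NormalForm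

/-! ## Termwise sums -/

/-- Termwise sums modulo `planarGroup`: if `cᵢ − dᵢ ∈ planarGroup` for `i ∈ s` then
`∑ cᵢ − ∑ dᵢ ∈ planarGroup`. [folklore] -/
theorem sum_sub_sum_mem_planarGroup {ι : Type*} (s : Finset ι) (c d : ι → KZ.FormalRep)
    (h : ∀ i ∈ s, c i - d i ∈ planarGroup) : ∑ i ∈ s, c i - ∑ i ∈ s, d i ∈ planarGroup := by
  rw [← Finset.sum_sub_distrib]
  exact sum_mem h

/-! ## The vertical shear -/

/-- **The vertical shear is a change-of-variables move.** Let `U ⊆ ℝᵐ` and let `lo` be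
`ℚ`-semialgebraic on `U` and differentiable at every point of `U`.  For a representation `r` with
integrand `1` on the open band `{(x, y) | x ∈ U, lo x < y < hi x}` and a representation `r'` with
integrand `1` on the cell `{(x, y) | x ∈ U, 0 < y < f x}` with `f = hi − lo` on `U`,
`[r] − [r']` is an instance of Kontsevich–Zagier's rule (2) along `Φ (x, y) = (x, y − lo x)`
(`ℚ`-semialgebraic, injective, differentiable with Jacobian determinant `1`,
`LinearMap.det_of_snoc_init`). [Kontsevich–Zagier 2001, §1.2, rule (2)] [folklore] -/
theorem of_sub_of_mem_changeOfVariablesRel_shear {m : ℕ} {U : Set (Fin m → ℝ)}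
    {lo hi f : (Fin m → ℝ) → ℝ} (hlo : IsSemialgebraicFunOn ℚ U lo)
    (hlod : ∀ y ∈ U, DifferentiableAt ℝ lo y) (hf : ∀ y ∈ U, f y = hi y - lo y)
    (r r' : KZ.IntegralRep (m + 1))
    (hr : ∀ z, z ∈ r.domain ↔
      Fin.init z ∈ U ∧ lo (Fin.init z) < z (Fin.last m) ∧ z (Fin.last m) < hi (Fin.init z))
    (hr' : ∀ w, w ∈ r'.domain ↔
      Fin.init w ∈ U ∧ 0 < w (Fin.last m) ∧ w (Fin.last m) < f (Fin.init w))
    (hr1 : ∀ z ∈ r.domain, r.integrand z = 1) (hr'1 : ∀ w ∈ r'.domain, r'.integrand w = 1) :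
    KZ.of r - KZ.of r' ∈ KZ.changeOfVariablesRel := by
  -- adapted from `KZ.of_sub_of_mem_relations_of_affine` (KZLogCalculusProofs.lean): `α = -lo`, `β = 1`
  have hmemU : ∀ z ∈ r.domain, Fin.init z ∈ U := fun z hz => ((hr z).1 hz).1
  have hlod' : ∀ y ∈ U, HasFDerivAt lo (fderiv ℝ lo y) y := fun y hy => (hlod y hy).hasFDerivAt
  -- the substitution
  set Φ : (Fin (m + 1) → ℝ) → (Fin (m + 1) → ℝ) := fun z =>
    Fin.snoc (Fin.init z) (z (Fin.last m) - lo (Fin.init z)) with hΦ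
  -- continuous linear pieces
  let initL : (Fin (m + 1) → ℝ) →L[ℝ] (Fin m → ℝ) :=
    ContinuousLinearMap.pi fun i => ContinuousLinearMap.proj (Fin.castSucc i)
  let lastL : (Fin (m + 1) → ℝ) →L[ℝ] ℝ := ContinuousLinearMap.proj (Fin.last m)
  have hinitL : ∀ w, initL w = Fin.init w := fun w => rfl
  have hlastL : ∀ w, lastL w = w (Fin.last m) := fun w => rfl
  let row : (Fin (m + 1) → ℝ) → (Fin (m + 1) → ℝ) →L[ℝ] ℝ := fun z =>
    lastL - (fderiv ℝ lo (Fin.init z)).comp initL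
  have hrow : ∀ z w, row z w = w (Fin.last m) - fderiv ℝ lo (Fin.init z) (Fin.init w) := by
    intro z w
    simp [row, hinitL, hlastL]
  let Φ' : (Fin (m + 1) → ℝ) → (Fin (m + 1) → ℝ) →L[ℝ] (Fin (m + 1) → ℝ) := fun z =>
    ContinuousLinearMap.pi
      (Fin.lastCases (motive := fun _ => (Fin (m + 1) → ℝ) →L[ℝ] ℝ) (row z)
        (fun i => ContinuousLinearMap.proj (Fin.castSucc i)))
  have hΦ' : ∀ z w, Φ' z w = Fin.snoc (Fin.init w) (row z w) := by
    intro z w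
    funext i
    refine Fin.lastCases ?_ (fun j => ?_) i
    · simp [Φ']
    · simp [Φ', Fin.init]
  -- determinant
  have hdet : ∀ z, (Φ' z).det = 1 := by
    intro z
    have h := LinearMap.det_of_snoc_init (Φ' z : (Fin (m + 1) → ℝ) →ₗ[ℝ] (Fin (m + 1) → ℝ))
      LinearMap.id (-((fderiv ℝ lo (Fin.init z) : (Fin m → ℝ) →L[ℝ] ℝ) : (Fin m → ℝ) →ₗ[ℝ] ℝ))
      1 (fun w => by
        rw [ContinuousLinearMap.coe_coe, hΦ', hrow]
        simp only [LinearMap.id_coe, id_eq, LinearMap.neg_apply, ContinuousLinearMap.coe_coe,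
          one_mul]
        ring_nf)
    rw [LinearMap.det_id, mul_one] at h
    exact h
  -- derivative
  have hderiv : ∀ z : Fin (m + 1) → ℝ, Fin.init z ∈ U → HasFDerivAt Φ (Φ' z) z := by
    intro z hz
    rw [hasFDerivAt_pi']
    intro i
    refine Fin.lastCases ?_ (fun j => ?_) i
    · have h1 : HasFDerivAt (fun x : Fin (m + 1) → ℝ => Fin.init x) initL z := initL.hasFDerivAt
      have hloc := (hlod' _ hz).comp z h1
      have hl : HasFDerivAt (fun x : Fin (m + 1) → ℝ => x (Fin.last m)) lastL z :=
        hasFDerivAt_apply (Fin.last m) z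
      have h := hl.sub hloc
      have hfun : (fun x => Φ x (Fin.last m)) =
          fun x => x (Fin.last m) - (lo ∘ fun x : Fin (m + 1) → ℝ => Fin.init x) x := by
        funext x
        simp [hΦ]
      show HasFDerivAt (fun x => Φ x (Fin.last m)) _ z
      rw [hfun]
      refine h.congr_fderiv (ContinuousLinearMap.ext fun w => ?_)
      simp only [ContinuousLinearMap.coe_comp, Function.comp_apply, hΦ', hrow]
      simp [hinitL, hlastL]
    · have hfun : (fun x => Φ x (Fin.castSucc j)) = fun x => x (Fin.castSucc j) := by
        funext x
        simp [hΦ, Fin.init]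
      show HasFDerivAt (fun x => Φ x (Fin.castSucc j)) _ z
      rw [hfun]
      refine (hasFDerivAt_apply (Fin.castSucc j) z).congr_fderiv
        (ContinuousLinearMap.ext fun w => ?_)
      simp [hΦ', Fin.init]
  -- semialgebraicity of the pieces on the band
  have hloi : IsSemialgebraicFunOn ℚ r.domain (fun z => lo (Fin.init z)) :=
    hlo.comp_init_mono r.isSemialgebraic_domain hmemU
  have hli := isSemialgebraicFunOn_apply r.isSemialgebraic_domain (Fin.last m)
  refine ⟨m + 1, r, r', Φ, Φ', ?_, ?_, ?_, ?_, ?_, rfl⟩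
  · -- semialgebraic map
    refine (isSemialgebraicMapOn_iff_forall_holds r.isSemialgebraic_domain).mpr fun i => ?_
    refine Fin.lastCases ?_ (fun j => ?_) i
    · exact (IsSemialgebraicFunOn.sub_holds hli hloi).congr fun z _ => by simp [hΦ]
    · exact (isSemialgebraicFunOn_aeval r.isSemialgebraic_domain
        (MvPolynomial.X (Fin.castSucc j))).congr fun z _ => by simp [hΦ, Fin.init]
  · exact fun z hz => (hderiv z (hmemU z hz)).hasFDerivWithinAt
  · intro z₁ hz₁ z₂ hz₂ h
    have hy : Fin.init z₁ = Fin.init z₂ := by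
      have := congrArg Fin.init h
      simpa [hΦ] using this
    have hl : z₁ (Fin.last m) - lo (Fin.init z₁) = z₂ (Fin.last m) - lo (Fin.init z₂) := by
      have := congrFun h (Fin.last m)
      simpa [hΦ] using this
    rw [hy] at hl
    have hs : z₁ (Fin.last m) = z₂ (Fin.last m) := sub_left_inj.mp hl
    rw [← Fin.snoc_init_self z₁, ← Fin.snoc_init_self z₂, hy, hs]
  · ext w
    rw [hr' w, mem_image]
    constructor
    · intro hw
      have hy : Fin.init w ∈ U := hw.1
      refine ⟨Fin.snoc (Fin.init w) (w (Fin.last m) + lo (Fin.init w)), ?_, ?_⟩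
      · rw [hr]
        refine ⟨by simpa using hy, ?_, ?_⟩
        · simp only [Fin.init_snoc, Fin.snoc_last]
          linarith [hw.2.1]
        · simp only [Fin.init_snoc, Fin.snoc_last]
          have := hw.2.2
          rw [hf _ hy] at this
          linarith
      · simp only [hΦ, Fin.init_snoc, Fin.snoc_last]
        rw [add_sub_cancel_right, Fin.snoc_init_self]
    · rintro ⟨z, hz, rfl⟩
      have hy : Fin.init z ∈ U := hmemU z hz
      rw [hr] at hz
      refine ⟨by simpa [hΦ] using hy, ?_, ?_⟩
      · simp only [hΦ, Fin.snoc_last]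
        linarith [hz.2.1]
      · simp only [hΦ, Fin.init_snoc, Fin.snoc_last]
        rw [hf _ hy]
        linarith [hz.2.2]
  · intro z hz
    have hΦz : Φ z ∈ r'.domain := by
      rw [hr']
      have hy : Fin.init z ∈ U := hmemU z hz
      have hz' := (hr z).1 hz
      refine ⟨by simpa [hΦ] using hy, ?_, ?_⟩
      · simp only [hΦ, Fin.snoc_last]
        linarith [hz'.2.1]
      · simp only [hΦ, Fin.init_snoc, Fin.snoc_last]
        rw [hf _ hy]
        linarith [hz'.2.2]
    rw [hr1 z hz, hr'1 _ hΦz, hdet, abs_one, mul_one]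

/-- **The vertical shear in the plane, modulo `planarGroup`.** For `U ⊆ ℝ¹`, `lo`
`ℚ`-semialgebraic on `U` and differentiable at every point of `U`, the planar open band
`{(x, y) | x ∈ U, lo x < y < hi x}` and the cell `{(x, y) | x ∈ U, 0 < y < f x}` (`f = hi − lo`
on `U`; written in the coordinates `p 0, p 1` of the cell compiler) are congruent modulo the
planar set-chain group. [Kontsevich–Zagier 2001, §1.2, rule (2)] [folklore] -/
theorem of_sub_of_mem_planarGroup_shear {U : Set (Fin 1 → ℝ)}
    {lo hi f : (Fin 1 → ℝ) → ℝ} (hlo : IsSemialgebraicFunOn ℚ U lo)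
    (hlod : ∀ y ∈ U, DifferentiableAt ℝ lo y) (hf : ∀ y ∈ U, f y = hi y - lo y)
    (r r' : KZ.IntegralRep 2)
    (hr : ∀ z, z ∈ r.domain ↔
      Fin.init z ∈ U ∧ lo (Fin.init z) < z (Fin.last 1) ∧ z (Fin.last 1) < hi (Fin.init z))
    (hr' : ∀ p, p ∈ r'.domain ↔
      (fun _ : Fin 1 => p 0) ∈ U ∧ 0 < p 1 ∧ p 1 < f (fun _ : Fin 1 => p 0))
    (hr1 : ∀ z ∈ r.domain, r.integrand z = 1) (hr'1 : ∀ p ∈ r'.domain, r'.integrand p = 1) :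
    KZ.of r - KZ.of r' ∈ planarGroup := by
  have hinit : ∀ w : Fin 2 → ℝ, Fin.init w = fun _ : Fin 1 => w 0 := fun w => by
    funext i
    rw [Subsingleton.elim i 0]
    rfl
  have hr'' : ∀ w : Fin 2 → ℝ, w ∈ r'.domain ↔
      Fin.init w ∈ U ∧ 0 < w (Fin.last 1) ∧ w (Fin.last 1) < f (Fin.init w) := fun w => by
    rw [hr', hinit]
    rfl
  exact AddSubgroup.subset_closure
    ⟨Or.inr (of_sub_of_mem_changeOfVariablesRel_shear hlo hlod hf r r' hr hr'' hr1 hr'1),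
      sub_mem (AddSubgroup.subset_closure ⟨r, hr1, rfl⟩) (AddSubgroup.subset_closure ⟨r', hr'1, rfl⟩)⟩

end Summit.KontsevichZagierPeriods.SymplecticScissors.PlanarCompilerProof.NormalForm

namespace Summit.KontsevichZagierPeriods.SymplecticScissors.PlanarCompilerProof

/-- **Registered sub-goal `stub_normalForm_shear` of stub `stub_normalForm`.** The vertical shear
`(x, y) ↦ (x, y − lo x)` carries the planar open band `{x ∈ U, lo x < y < hi x}` onto the cell
`{x ∈ U, 0 < y < f x}` (`f = hi − lo` on `U`) modulo the planar set-chain group `G`, as soon as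
`lo` is `ℚ`-semialgebraic on `U` and differentiable at every point of `U`
(`NormalForm.of_sub_of_mem_planarGroup_shear`). [Kontsevich–Zagier 2001, §1.2, rule (2)] [folklore] -/
theorem stub_normalForm_shear : ∀ (U : Set (Fin 1 → ℝ)) (lo hi f : (Fin 1 → ℝ) → ℝ), IsSemialgebraicFunOn ℚ U lo → (∀ y ∈ U, DifferentiableAt ℝ lo y) → (∀ y ∈ U, f y = hi y - lo y) → ∀ (r r' : KZ.IntegralRep 2), (∀ z : Fin 2 → ℝ, z ∈ r.domain ↔ Fin.init z ∈ U ∧ lo (Fin.init z) < z (Fin.last 1) ∧ z (Fin.last 1) < hi (Fin.init z)) → (∀ p : Fin 2 → ℝ, p ∈ r'.domain ↔ (fun _ : Fin 1 => p 0) ∈ U ∧ 0 < p 1 ∧ p 1 < f (fun _ : Fin 1 => p 0)) → (∀ z ∈ r.domain, r.integrand z = 1) → (∀ p ∈ r'.domain, r'.integrand p = 1) → KZ.of r - KZ.of r' ∈ AddSubgroup.closure ((KZ.domainAddRel ∪ KZ.changeOfVariablesRel) ∩ (AddSubgroup.closure {x : KZ.FormalRep | ∃ s : KZ.IntegralRep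 2, (∀ p ∈ s.domain, s.integrand p = 1) ∧ x = KZ.of s} : Set KZ.FormalRep)) :=
  fun _ _ _ _ hlo hlod hf r r' hr hr' hr1 hr'1 =>
    NormalForm.of_sub_of_mem_planarGroup_shear hlo hlod hf r r' hr hr' hr1 hr'1

end Summit.KontsevichZagierPeriods.SymplecticScissors.PlanarCompilerProof
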